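import Summits.Ventures.PercRepro.PuncturedLYMSuperMain

/-!
# PercRepro — (SP) BY SUPERPOSITION, PART 7: THEOREM C — (SP) HOLDS FOR EVERY CODE WITH `2·#D ≤ n − j` (p10, gen 31)

The same corrected superposition `totalW`, bounded word by word instead of class by class: every deficit `e(a)` is at most
`1/(n − j − 1)` (`eDef_le_inv`: `e(a) = τ·C_{≤a}/(C(j,a)·C(n−j,t)·t)`, `t = j + 1 − a`, and `C(N,t)·t ≥ N(N−1)` for
`2 ≤ t ≤ N − 1`, `C(N,N)·N = N` at the boundary class), so `N(X) ≤ #D/(n−j−1)`, every positive error is at most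
`(#D − 1)/((n−j−1)(n−j))`, and `(n−j)·totalW ≥ 1 − (2·#D − 1)/(n − j − 1) ≥ 0` when `2·#D ≤ n − j`.
* **`puncturedNMP_of_few_words`** — (SP) for every code `D` with `1 ≤ j`, `2j + 1 ≤ n` and `2·#D ≤ n − j`; in particular
  every code with two words and `n − j ≥ 4` (the first asymmetric case of gen 30's gradient bound, now unconditional).
Nothing here asserts (SP) in general.
-/

namespace PercRepro.PuncturedLYM

open Finset

variable {α : Type} [Fintype α] [DecidableEq α]

/-! ### `C(m, k) ≥ m` for `1 ≤ k ≤ m − 1` -/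

/-- `m ≤ C(m, k)` for `1 ≤ k ≤ m − 1`. -/
theorem le_choose_of_mem_Ioo (m k : ℕ) (hk1 : 1 ≤ k) (hkm : k + 1 ≤ m) : m ≤ m.choose k := by
  induction m generalizing k with
  | zero => omega
  | succ m ih =>
    rcases Nat.eq_or_lt_of_le hk1 with h1 | h1
    · subst h1
      rw [Nat.choose_one_right]
    rcases Nat.eq_or_lt_of_le hkm with h2 | h2
    · have : k = m := by omega
      subst this
      rw [Nat.choose_succ_self_right]
    · obtain ⟨k', rfl⟩ : ∃ k', k = k' + 1 := ⟨k - 1, by omega⟩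
      rw [Nat.choose_succ_succ]
      have hA := ih k' (by omega) (by omega)
      have hB := ih (k' + 1) (by omega) (by omega)
      calc m + 1 ≤ m + m := by omega
        _ ≤ m.choose k' + m.choose (k' + 1) := Nat.add_le_add hA hB

/-- `N(N − 1) ≤ C(N, t)·t` for `2 ≤ t ≤ N − 1`. -/
theorem choose_mul_ge_mul (N t : ℕ) (ht2 : 2 ≤ t) (htN : t + 1 ≤ N) : N * (N - 1) ≤ N.choose t * t := by
  obtain ⟨N', rfl⟩ : ∃ N', N = N' + 1 := ⟨N - 1, by omega⟩
  obtain ⟨t', rfl⟩ : ∃ t', t = t' + 1 := ⟨t - 1, by omega⟩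
  have h := Nat.add_one_mul_choose_eq N' t'
  -- `(N'+1) · C(N', t') = C(N'+1, t'+1) · (t'+1)`
  have hle := le_choose_of_mem_Ioo N' t' (by omega) (by omega)
  rw [Nat.add_sub_cancel]
  calc (N' + 1) * N' ≤ (N' + 1) * N'.choose t' := Nat.mul_le_mul_left _ hle
    _ = (N' + 1).choose (t' + 1) * (t' + 1) := h

/-! ### The uniform deficit bound `e(a) ≤ 1/(n − j − 1)` -/

omit [DecidableEq α] in
/-- **`e(a) ≤ 1/(n − j − 1)`** for every class `a < j` (`2j + 1 ≤ n`). -/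
theorem eDef_le_inv {j a : ℕ} (ha : a < j) (hn : 2 * j + 1 ≤ Fintype.card α) :
    eDef α j a ≤ 1 / ((Fintype.card α : ℚ) - j - 1) := by
  obtain ⟨n, hn_def⟩ : ∃ n, Fintype.card α = n := ⟨_, rfl⟩
  rw [hn_def] at hn
  -- write `n = N + 1 + j`, so `n − j = N + 1` and `n − j − 1 = N`
  obtain ⟨N, rfl⟩ : ∃ N, n = N + 1 + j := ⟨n - j - 1, by omega⟩
  unfold eDef dFlux tauQ
  simp only [hn_def]
  have hNj : N + 1 + j - j = N + 1 := Nat.add_sub_cancel _ _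
  have hcut : cutEdges (N + 1 + j) j a = classCount (N + 1 + j) j a * (j + 1 - a) * (j - a) := rfl
  have hcc : classCount (N + 1 + j) j a = j.choose a * (N + 1).choose (j + 1 - a) := by
    unfold classCount
    rw [hNj]
  have hcum : cumCount (N + 1 + j) j a ≤ (N + 1 + j).choose (j + 1) := cumCount_le_choose (by omega) (by omega)
  set t := j + 1 - a with ht_def
  have hN1 : (0 : ℚ) < (N : ℚ) := by
    have : 0 < N := by omega
    exact_mod_cast this
  have hYpos : (0 : ℚ) < ((N + 1 + j).choose (j + 1) : ℚ) := by
    have : 0 < (N + 1 + j).choose (j + 1) := Nat.choose_pos (by omega)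
    exact_mod_cast this
  have hcpos : (0 : ℚ) < ((N + 1).choose t : ℚ) := by
    have : 0 < (N + 1).choose t := Nat.choose_pos (by omega)
    exact_mod_cast this
  have htpos : (0 : ℚ) < (t : ℚ) := by
    have : 0 < t := by omega
    exact_mod_cast this
  have hjapos : (0 : ℚ) < ((j : ℚ) - a) := by
    have : (a : ℚ) < j := by exact_mod_cast ha
    linarith
  have hjcpos : (0 : ℚ) < (j.choose a : ℚ) := by
    have : 0 < j.choose a := Nat.choose_pos ha.le
    exact_mod_cast this
  -- the main inequality in ℕ: `(N+1)·N·cum ≤ C(n, j+1)·C(j,a)·C(N+1,t)·t`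
  have hmain : (N + 1) * N * cumCount (N + 1 + j) j a ≤
      (N + 1 + j).choose (j + 1) * (j.choose a * ((N + 1).choose t * t)) := by
    rcases Nat.lt_or_ge t (N + 1) with hint | hbd
    · -- interior class `t ≤ N`
      have h1 := choose_mul_ge_mul (N + 1) t (by omega) (by omega)
      rw [Nat.add_sub_cancel] at h1
      calc (N + 1) * N * cumCount (N + 1 + j) j a ≤ ((N + 1).choose t * t) * (N + 1 + j).choose (j + 1) :=
            Nat.mul_le_mul h1 hcum
        _ = (N + 1 + j).choose (j + 1) * (1 * ((N + 1).choose t * t)) := by ring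
        _ ≤ (N + 1 + j).choose (j + 1) * (j.choose a * ((N + 1).choose t * t)) := by
            have : 1 ≤ j.choose a := Nat.choose_pos ha.le
            exact Nat.mul_le_mul_left _ (Nat.mul_le_mul_right _ this)
    · -- the boundary class `t = N + 1` (only when `a = 0`, `j = N`): `C(N+1, N+1)·(N+1) = N + 1` and `N ≤ C(2N+1, N+1)`
      have htN : t = N + 1 := by omega
      have ha0 : a = 0 := by omega
      have hjN : j = N := by omega
      have hcum0 : cumCount (N + 1 + j) j a = 1 := by
        rw [ha0]
        unfold cumCount classCount
        rw [Finset.sum_range_one, Nat.choose_zero_right, one_mul, Nat.sub_zero, hNj, hjN, Nat.choose_self]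
      rw [hcum0, htN, Nat.choose_self, ha0, Nat.choose_zero_right, one_mul, one_mul, mul_one]
      have : N ≤ (N + 1 + j).choose (j + 1) := by
        have := le_choose_of_mem_Ioo (N + 1 + j) (j + 1) (by omega) (by omega)
        omega
      nlinarith
  have hmainq : ((N : ℚ) + 1) * (N : ℚ) * (cumCount (N + 1 + j) j a : ℚ) ≤
      ((N + 1 + j).choose (j + 1) : ℚ) * ((j.choose a : ℚ) * (((N + 1).choose t : ℚ) * t)) := by
    exact_mod_cast hmain
  -- assemble
  rw [hcut, hcc]
  push_cast [Nat.cast_sub (by omega : a ≤ j + 1), Nat.cast_sub ha.le]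
  simp only [add_sub_cancel_right]
  have key : ((j : ℚ) - a) * (((N : ℚ) + 1) / ((N + 1 + j).choose (j + 1) : ℚ) * (cumCount (N + 1 + j) j a : ℚ) /
      ((j.choose a : ℚ) * ((N + 1).choose t : ℚ) * (t : ℚ) * ((j : ℚ) - a))) =
      ((N : ℚ) + 1) * (cumCount (N + 1 + j) j a : ℚ) /
        (((N + 1 + j).choose (j + 1) : ℚ) * ((j.choose a : ℚ) * (((N + 1).choose t : ℚ) * t))) := by
    field_simp
  rw [key, div_le_div_iff₀ (by positivity) hN1]
  nlinarith [hmainq]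

/-! ### Theorem C -/

/-- **THEOREM C: (SP) holds for every code with `1 ≤ j`, `2j + 1 ≤ n` and `2·#D ≤ n − j`.** -/
theorem puncturedNMP_of_few_words {j : ℕ} {D : Finset (Finset α)} (hD : IsCode j D) (hj : 1 ≤ j)
    (hn : 2 * j + 1 ≤ Fintype.card α) (hk : 2 * D.card ≤ Fintype.card α - j) : PuncturedNMP j D := by
  have hjn : j < Fintype.card α := by omega
  have hj0 : 0 < j := hj
  have hn2 : 2 * j ≤ Fintype.card α := by omega
  have hnj : (0 : ℚ) < (Fintype.card α : ℚ) - j := by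
    have : (j : ℚ) < Fintype.card α := by exact_mod_cast hjn
    linarith
  have hnj1 : (0 : ℚ) < (Fintype.card α : ℚ) - j - 1 := by
    have : (j + 1 : ℚ) < Fintype.card α := by
      have : j + 1 < Fintype.card α := by omega
      exact_mod_cast this
    linarith
  set ē : ℚ := 1 / ((Fintype.card α : ℚ) - j - 1) with hē
  have hē0 : 0 ≤ ē := by positivity
  -- the word-by-word profile bound: `Σ_{B ∈ S} e(#(X ∩ B)) ≤ #S · ē` for any subfamily `S ⊆ D` and any `j`-set `X ∉ S`
  have hprof : ∀ (S : Finset (Finset α)), S ⊆ D → ∀ X : Finset α, X.card = j → X ∉ S →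
      ∑ B ∈ S, eDef α j (X ∩ B).card ≤ (S.card : ℚ) * ē := by
    intro S hS X hX hXS
    calc ∑ B ∈ S, eDef α j (X ∩ B).card ≤ ∑ B ∈ S, ē := by
          apply sum_le_sum
          intro B hB
          have hne : X ≠ B := fun h => hXS (h ▸ hB)
          have ha := aOf_lt (hD.1 B (hS hB)) hX hne
          exact eDef_le_inv ha hn
      _ = (S.card : ℚ) * ē := by rw [sum_const, nsmul_eq_mul]
  -- the error bound `M = (#D − 1)⁺·ē/(n − j)`
  set M : ℚ := max ((D.card : ℚ) - 1) 0 * ē / ((Fintype.card α : ℚ) - j) with hM_def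
  have hM0 : 0 ≤ M := div_nonneg (mul_nonneg (le_max_right _ _) hē0) hnj.le
  have hM : ∀ B ∈ D, ∀ y' ∉ B, max (errE α j D B y') 0 ≤ M := by
    intro B hB y' _
    have hDpos : 1 ≤ D.card := card_pos.2 ⟨B, hB⟩
    calc max (errE α j D B y') 0
        ≤ (∑ B' ∈ D.erase B, eDef α j (B ∩ B').card) / ((Fintype.card α : ℚ) - j) := max_errE_le hD hn2 hjn hB y'
      _ ≤ ((D.erase B).card : ℚ) * ē / ((Fintype.card α : ℚ) - j) :=
          div_le_div_of_nonneg_right (hprof (D.erase B) (erase_subset B D) B (hD.1 B hB) (notMem_erase B D)) hnj.le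
      _ ≤ M := by
          rw [hM_def, card_erase_of_mem hB, Nat.cast_sub hDpos]
          apply div_le_div_of_nonneg_right _ hnj.le
          exact mul_le_mul_of_nonneg_right (le_max_left _ _) hē0
  set c : ℚ := ((punctured j D).card : ℚ) / (levelAbove α j).card with hc_def
  have hc0 : 0 ≤ c := by positivity
  refine puncturedNMP_of_weights (fun X Y => totalWp α j D X Y / c) ?_ ?_ ?_
  · -- nonnegativity: `totalW ≥ (1 − #D·ē)/(n−j) − M ≥ 0`
    intro X hX Y hY
    obtain ⟨hXc, hXD⟩ := mem_punctured.1 hX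
    rw [sups_eq hXc] at hY
    obtain ⟨y, hy, rfl⟩ := mem_image.1 hY
    rw [totalWp_insert j D X (mem_sdiff.1 hy).2]
    apply div_nonneg _ hc0
    have h1 := superW_ge hD hn2 hjn X y
    have h2 := sum_reroute_ge hD hjn hM0 hM hXc (mem_sdiff.1 hy).2
    have hN := hprof D (subset_refl D) X hXc hXD
    have hkq : (2 * D.card : ℚ) ≤ (Fintype.card α : ℚ) - j := by
      have : ((2 * D.card : ℕ) : ℚ) ≤ ((Fintype.card α - j : ℕ) : ℚ) := by exact_mod_cast hk
      push_cast [Nat.cast_sub hjn.le] at this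
      linarith
    have hfinal : 0 ≤ (1 - (D.card : ℚ) * ē) / ((Fintype.card α : ℚ) - j) - M := by
      rw [hM_def, ← sub_div]
      apply div_nonneg _ hnj.le
      rcases D.eq_empty_or_nonempty with h0 | ⟨B, hB⟩
      · rw [h0, card_empty]
        simp only [CharP.cast_eq_zero, zero_mul, sub_zero, zero_sub]
        rw [max_eq_right (by norm_num : (-1 : ℚ) ≤ 0), zero_mul, sub_zero]
        exact zero_le_one
      · have hDpos : (1 : ℚ) ≤ D.card := by exact_mod_cast card_pos.2 ⟨B, hB⟩
        rw [max_eq_left (by linarith)]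
        have : (2 * (D.card : ℚ) - 1) * ē ≤ 1 := by
          rw [hē, mul_one_div, div_le_one hnj1]
          linarith
        linarith
    have h3 : (1 - (D.card : ℚ) * ē) / ((Fintype.card α : ℚ) - j) ≤
        (1 - ∑ B ∈ D, eDef α j (X ∩ B).card) / ((Fintype.card α : ℚ) - j) :=
      div_le_div_of_nonneg_right (by linarith) hnj.le
    unfold totalW
    linarith
  · intro X hX
    rw [← sum_div, sum_sups_totalWp hD hjn hX, hc_def, one_div_div]
  · intro Y hY
    rw [← sum_div, sum_subsP_totalWp hD hj0 hjn (mem_levelAbove.1 hY), ← hc_def]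
    rcases eq_or_ne c 0 with hc | hc
    · rw [hc, div_zero]
      exact zero_le_one
    · rw [div_self hc]

end PercRepro.PuncturedLYM
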